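import Literature.NumberTheory.Transcendental.ChudnovskyZeroEstimate
import Literature.NumberTheory.Transcendental.ChudnovskyValues
import Literature.NumberTheory.Transcendental.ChudnovskySiegel
import Literature.NumberTheory.Transcendental.ChudnovskyMainBounds
import HarnessLib

/-!
# Chudnovsky's theorem on periods — the auxiliary construction at level `D`

Topic `Literature/NumberTheory/Transcendental` (trunk T-TRANSCEND). Node [AUX] of the proof of
`Literature.NumberTheory.Transcendental.Chudnovsky1984_thm_7_3_1` (Chudnovsky 1984, Ch. 7, Theorem 3.1): the steps of
Gelfond's method (Ch. 7, §2, pp. 305–307, variant (C); §3, pp. 309–310) at a fixed level `D`,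
with all constants explicit but not yet compared:

1. **Siegel** (`siegel_step`): integer polynomials `pp_l ∈ ℤ[T]`, `l ∈ [0,D]²`, not all zero,
   of degree `< A` and height `≤ (D+1)² A B`, such that the representing matrices
   `homEval N b n ∑_l C(pp_l)·(V j m l)` vanish for `j < T₀`, `m < X` — hence (`iteratedDeriv_eq_zero`)
   `F_p^{(j)}(s_m) = 0` for the coefficient family `p_l = pp_l(θ)`.
2. **Zero estimate** (`exists_iteratedDeriv_ne_zero`): some `ξ = F_p^{(j₀)}(s_{m₀}) ≠ 0` with
   `j₀ < T₁`, `m₀ < X`, as soon as `T₁ X² > C_Z (D+1)(X+D)²` (`p ≠ 0` because `θ` is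
   transcendental, `coeffFamily_ne_zero`).
3. **Upper bound** (`norm_coeffFamily_le` with `norm_iteratedDeriv_F_le_of_zeros`).
4. **Norm** (`aeval_det_ne_zero`, `natDegree_det_le`, `norm_aeval_det_le`): the
   polynomial `Q = det (homEval N b n₁ ∑_l C(pp_l)·(V j₀ m₀ l)) ∈ ℤ[T]` has `Q(θ) ≠ 0`, controlled
   degree and height, and `|Q(θ)| ≤ |b(θ)|^{n₁} |ξ| · d (1 + d R)^d`.

## Contents (no definitions)

* `evC_Pmix`, `iteratedDeriv_F_s_eq_evC`, `coeff_Pmix`, `degree_le_of_mem_support_Pmix`,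
  `homEval_Pmix` — the mixed polynomials `∑_l C(pp_l)·(V j m l)` (written out as explicit sums);
* `natDegree_homEval_V_le`, `zl1_homEval_V_le`, `siegel_step`, `iteratedDeriv_eq_zero`,
  `aeval_ne_zero_of_transcendental`, `coeffFamily_ne_zero`, `norm_coeffFamily_le`,
  `exists_iteratedDeriv_ne_zero`, `natDegree_coeff_Pmix_le`, `wnorm_Pmix_le`,
  `aeval_det_ne_zero`, `natDegree_det_le`, `norm_aeval_det_le` (the height of `det` is
  `zl1_det_le_of_entry` of `ChudnovskyMainBounds.lean`).
-/

noncomputable section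

open scoped Polynomial
open Complex Finset MvPolynomial Matrix

namespace Literature.NumberTheory.Transcendental.Chudnovsky

variable (L : PeriodPair) {θ : ℂ} (E : Envelope θ (xv L))

/-! ### The mixed polynomials `∑_l C(pp_l) V j m l ∈ ℤ[T][a]` (written `∑_l C(pp_l)·(V j m l)` below) -/


section Pmix

variable {D : ℕ} (pp : Fin (D + 1) × Fin (D + 1) → ℤ[X]) (j m : ℕ)

/-- Specialising `Pmix`: `∑_l C(pp_l)·(V j m l)(θ; x) = ∑_l pp_l(θ) · φx (V j m l)`. [folklore] -/
theorem evC_Pmix (θ : ℂ) :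
    evC θ (xv L) (∑ l : Fin _ × Fin _, MvPolynomial.C (pp l) *
        MvPolynomial.map (Polynomial.C : ℤ →+* Polynomial ℤ) (V j m l.1 l.2)) = ∑ l, Polynomial.aeval θ (pp l) * φx L (V j m l.1 l.2) := by
  rw [map_sum]
  refine Finset.sum_congr rfl fun l _ => ?_
  rw [map_mul, evC_C, evC_map_C]
  rfl

/-- Hence `F_p^{(j)}(s_m) = ∑_l C(pp_l)·(V j m l)(θ; x)` for the coefficient family `p_l = pp_l(θ)`.
[cite: Chudnovsky1984, Ch. 7 §2 p. 307] -/
theorem iteratedDeriv_F_s_eq_evC (θ : ℂ) :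
    iteratedDeriv j (F L D (fun l => Polynomial.aeval θ (pp l))) (s L m) =
      evC θ (xv L) (∑ l : Fin _ × Fin _, MvPolynomial.C (pp l) *
        MvPolynomial.map (Polynomial.C : ℤ →+* Polynomial ℤ) (V j m l.1 l.2)) := by
  rw [iteratedDeriv_F_s, evC_Pmix]

/-- The coefficients of `Pmix`: `coeff_α = ∑_l pp_l · C(coeff_α V j m l)`. [folklore] -/
theorem coeff_Pmix (α : Fin 4 →₀ ℕ) :
    ((∑ l : Fin _ × Fin _, MvPolynomial.C (pp l) *
        MvPolynomial.map (Polynomial.C : ℤ →+* Polynomial ℤ) (V j m l.1 l.2))).coeff α = ∑ l, pp l * Polynomial.C ((V j m l.1 l.2).coeff α) := by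
  rw [MvPolynomial.coeff_sum]
  refine Finset.sum_congr rfl fun l _ => ?_
  rw [MvPolynomial.coeff_C_mul, MvPolynomial.coeff_map]

/-- Monomials of `∑_l C(pp_l)·(V j m l)` come from some `V j m i k`, `i, k ≤ D`, hence have degree
`≤ D + D + j`. [folklore] -/
theorem degree_le_of_mem_support_Pmix {α : Fin 4 →₀ ℕ} (hα : α ∈ ((∑ l : Fin _ × Fin _, MvPolynomial.C (pp l) *
        MvPolynomial.map (Polynomial.C : ℤ →+* Polynomial ℤ) (V j m l.1 l.2))).support) :
    α.degree ≤ D + D + j := by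
  rw [MvPolynomial.mem_support_iff, coeff_Pmix] at hα
  obtain ⟨l, -, hl⟩ := Finset.exists_ne_zero_of_sum_ne_zero hα
  have hlα : α ∈ (V j m l.1 l.2).support := by
    rw [MvPolynomial.mem_support_iff]
    intro h0
    exact hl (by rw [h0, map_zero, mul_zero])
  have h1 := degree_le_of_mem_support_V j m l.1 l.2 hlα
  have h2 : (l.1 : ℕ) ≤ D := Nat.lt_succ_iff.mp l.1.2
  have h3 : (l.2 : ℕ) ≤ D := Nat.lt_succ_iff.mp l.2.2
  omega

/-- `homEval` of `Pmix` is the corresponding combination of the `homEval (V j m l)`.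
[folklore] -/
theorem homEval_Pmix {d : ℕ} (N : Fin 4 → Matrix (Fin d) (Fin d) ℤ[X]) (b : ℤ[X]) (n : ℕ) :
    homEval N b n (∑ l : Fin _ × Fin _, MvPolynomial.C (pp l) *
        MvPolynomial.map (Polynomial.C : ℤ →+* Polynomial ℤ) (V j m l.1 l.2)) =
      ∑ l, pp l • homEval N b n (MvPolynomial.map (Polynomial.C : ℤ →+* ℤ[X]) (V j m l.1 l.2)) := by
  rw [homEval_sum]
  refine Finset.sum_congr rfl fun l _ => ?_
  rw [homEval_C_mul]

end Pmix


/-! ### The entries of the Siegel system -/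

/-- Support of `map C V`: monomials have degree `≤ i + k + j`. [folklore] -/
lemma degree_le_of_mem_support_map_V {j m i k : ℕ} {α : Fin 4 →₀ ℕ}
    (hα : α ∈ (MvPolynomial.map (Polynomial.C : ℤ →+* ℤ[X]) (V j m i k)).support) :
    α.degree ≤ i + k + j :=
  degree_le_of_mem_support_V j m i k (support_map_subset _ _ hα)

/-- Degrees of the entries `homEval N b n (V j m i k)`: `≤ n δ₀`. [folklore] -/
theorem natDegree_homEval_V_le {δ₀ : ℕ} (hN : ∀ l i j, (E.N l i j).natDegree ≤ δ₀)
    (hb : E.b.natDegree ≤ δ₀) {n j m i k : ℕ} (hn : i + k + j ≤ n) (i₁ i₂ : Fin E.d) :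
    (homEval E.N E.b n (MvPolynomial.map (Polynomial.C : ℤ →+* ℤ[X]) (V j m i k)) i₁ i₂).natDegree
      ≤ n * δ₀ := by
  have h := natDegree_homEval_entry_le (δP := 0)
    (P := MvPolynomial.map (Polynomial.C : ℤ →+* ℤ[X]) (V j m i k)) hN hb
    (fun α hα => (degree_le_of_mem_support_map_V hα).trans hn)
    (fun α => by rw [MvPolynomial.coeff_map, Polynomial.natDegree_C]) i₁ i₂
  simpa using h

/-- Heights of the entries `homEval N b n (V j m i k)`:
`≤ (7(i+k+j))^j (m+1)^{i+k+j} d³ (d H₀)^n`. [folklore] -/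
theorem zl1_homEval_V_le {H₀ : ℝ} (hH₀ : 1 ≤ H₀) (hN : ∀ l i j, zl1 (E.N l i j) ≤ H₀)
    (hb : zl1 E.b ≤ H₀) {n j m i k : ℕ} (hn : i + k + j ≤ n) (i₁ i₂ : Fin E.d) :
    zl1 (homEval E.N E.b n (MvPolynomial.map (Polynomial.C : ℤ →+* ℤ[X]) (V j m i k)) i₁ i₂) ≤
      (7 * ((i : ℝ) + k + j)) ^ j * ((m : ℝ) + 1) ^ (i + k + j) *
        ((E.d : ℝ) ^ 3 * (E.d * H₀) ^ n) := by
  have h := seminorm_homEval_entry_le zl1 zl1_one.le hH₀ hN hb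
    (P := MvPolynomial.map (Polynomial.C : ℤ →+* ℤ[X]) (V j m i k))
    (fun α hα => (degree_le_of_mem_support_map_V hα).trans hn) i₁ i₂
  refine h.trans (mul_le_mul_of_nonneg_right ?_ (by positivity))
  refine (wnorm_map_le _ _ _ (fun a => by rw [zl1_C, normRingSeminorm_int_apply]) _).trans ?_
  exact l1_V_le j m i k

/-! ### Siegel's step -/

/-- **Siegel's step** (Chudnovsky 1984, Ch. 7, §2, p. 307 and §3, p. 309). If
`8 T₀ X d² ≤ (D+1)²` (`T₀, X ≥ 1`), there are integer polynomials `pp_l ∈ ℤ[T]`, `l ∈ [0,D]²`,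
not all zero, of degree `< A = nδ₀ + 1` (`n = 2D + T₀`) and coefficients bounded by
`(D+1)² A B`, `B = (7n)ⁿ Xⁿ d³ (dH₀)ⁿ`, such that the representing matrices of
`∑_l C(pp_l)·(V j m l)` vanish for all `j < T₀`, `m < X`. [cite: Chudnovsky1984, Ch. 7 §2 p. 307] -/
theorem siegel_step {δ₀ : ℕ} {H₀ : ℝ} (hH₀ : 1 ≤ H₀)
    (hNδ : ∀ l i j, (E.N l i j).natDegree ≤ δ₀) (hbδ : E.b.natDegree ≤ δ₀)
    (hNH : ∀ l i j, zl1 (E.N l i j) ≤ H₀) (hbH : zl1 E.b ≤ H₀)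
    (D T₀ X : ℕ) (hT₀ : 1 ≤ T₀) (hX : 1 ≤ X) (hcount : 8 * (T₀ * X * E.d ^ 2) ≤ (D + 1) ^ 2) :
    ∃ pp : Fin (D + 1) × Fin (D + 1) → ℤ[X], pp ≠ 0 ∧
      (∀ l, (pp l).natDegree < (D + D + T₀) * δ₀ + 1) ∧
      (∀ l kk, |((pp l).coeff kk : ℝ)| ≤
        ((D : ℝ) + 1) ^ 2 * ((D + D + T₀) * δ₀ + 1 : ℕ) *
          ((7 * ((D : ℝ) + D + T₀)) ^ (D + D + T₀) * (X : ℝ) ^ (D + D + T₀) *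
            ((E.d : ℝ) ^ 3 * (E.d * H₀) ^ (D + D + T₀)))) ∧
      ∀ j < T₀, ∀ m < X, homEval E.N E.b (D + D + T₀) (∑ l : Fin _ × Fin _, MvPolynomial.C (pp l) *
        MvPolynomial.map (Polynomial.C : ℤ →+* Polynomial ℤ) (V j m l.1 l.2)) = 0 := by
  classical
  set n : ℕ := D + D + T₀ with hn
  set A : ℕ := n * δ₀ + 1 with hA
  set B : ℝ := (7 * ((D : ℝ) + D + T₀)) ^ n * (X : ℝ) ^ n * ((E.d : ℝ) ^ 3 * (E.d * H₀) ^ n)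
    with hB
  have hd : 1 ≤ E.d := E.d_pos
  have hd' : (1 : ℝ) ≤ E.d := by exact_mod_cast hd
  have hX' : (1 : ℝ) ≤ X := by exact_mod_cast hX
  have hn1 : 1 ≤ n := by omega
  have hnR : (n : ℝ) = (D : ℝ) + D + T₀ := by rw [hn]; push_cast; ring
  have h7n : (1 : ℝ) ≤ 7 * ((D : ℝ) + D + T₀) := by
    rw [← hnR]; have : (1 : ℝ) ≤ n := by exact_mod_cast hn1
    linarith
  -- the system
  let ι := (Fin T₀ × Fin X) × (Fin E.d × Fin E.d)
  let W : ι → Fin (D + 1) × Fin (D + 1) → ℤ[X] := fun e l =>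
    homEval E.N E.b n (MvPolynomial.map (Polynomial.C : ℤ →+* ℤ[X]) (V e.1.1 e.1.2 l.1 l.2))
      e.2.1 e.2.2
  have hln : ∀ (e : ι) (l : Fin (D + 1) × Fin (D + 1)), (l.1 : ℕ) + l.2 + e.1.1 ≤ n := by
    intro e l
    have h1 : (l.1 : ℕ) ≤ D := Nat.lt_succ_iff.mp l.1.2
    have h2 : (l.2 : ℕ) ≤ D := Nat.lt_succ_iff.mp l.2.2
    have h3 : (e.1.1 : ℕ) < T₀ := e.1.1.2
    omega
  have hWδ : ∀ e l, (W e l).natDegree ≤ n * δ₀ := fun e l =>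
    natDegree_homEval_V_le L E hNδ hbδ (hln e l) _ _
  have hWB : ∀ e l kk, |((W e l).coeff kk : ℝ)| ≤ B := by
    intro e l kk
    refine (abs_coeff_le_zl1 _ _).trans ((zl1_homEval_V_le L E hH₀ hNH hbH (hln e l) _ _).trans ?_)
    rw [hB]
    have hm : ((e.1.2 : ℕ) : ℝ) + 1 ≤ X := by
      have := e.1.2.2; exact_mod_cast this
    have hikj : 7 * (((l.1 : ℕ) : ℝ) + (l.2 : ℕ) + (e.1.1 : ℕ)) ≤ 7 * ((D : ℝ) + D + T₀) := by
      have := hln e l; rw [← hnR]; gcongr; exact_mod_cast this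
    have h1 : (7 * (((l.1 : ℕ) : ℝ) + (l.2 : ℕ) + (e.1.1 : ℕ))) ^ (e.1.1 : ℕ) ≤
        (7 * ((D : ℝ) + D + T₀)) ^ n :=
      calc (7 * (((l.1 : ℕ) : ℝ) + (l.2 : ℕ) + (e.1.1 : ℕ))) ^ (e.1.1 : ℕ)
          ≤ (7 * ((D : ℝ) + D + T₀)) ^ (e.1.1 : ℕ) :=
            pow_le_pow_left₀ (by positivity) hikj _
        _ ≤ (7 * ((D : ℝ) + D + T₀)) ^ n :=
            pow_le_pow_right₀ h7n (by have := hln e l; omega)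
    have h2 : (((e.1.2 : ℕ) : ℝ) + 1) ^ ((l.1 : ℕ) + l.2 + e.1.1) ≤ (X : ℝ) ^ n :=
      calc (((e.1.2 : ℕ) : ℝ) + 1) ^ ((l.1 : ℕ) + l.2 + e.1.1) ≤ (X : ℝ) ^ ((l.1 : ℕ) + l.2 + e.1.1) :=
            pow_le_pow_left₀ (by positivity) hm _
        _ ≤ (X : ℝ) ^ n := pow_le_pow_right₀ hX' (hln e l)
    exact mul_le_mul_of_nonneg_right (mul_le_mul h1 h2 (by positivity) (by positivity))
      (by positivity)
  have hB1 : 1 ≤ B := by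
    rw [hB]
    have h1 : (1 : ℝ) ≤ (7 * ((D : ℝ) + D + T₀)) ^ n := one_le_pow₀ h7n
    have h2 : (1 : ℝ) ≤ (X : ℝ) ^ n := one_le_pow₀ hX'
    have h3 : (1 : ℝ) ≤ (E.d : ℝ) ^ 3 := one_le_pow₀ hd'
    have h4 : (1 : ℝ) ≤ ((E.d : ℝ) * H₀) ^ n := one_le_pow₀ (by nlinarith)
    calc (1 : ℝ) = 1 * 1 * (1 * 1) := by ring
      _ ≤ _ := by gcongr
  have hι : 0 < Fintype.card ι := by
    simp only [ι, Fintype.card_prod, Fintype.card_fin]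
    positivity
  have hAp : 0 < A := by omega
  have hcard : 2 * (Fintype.card ι * (A + n * δ₀)) ≤
      Fintype.card (Fin (D + 1) × Fin (D + 1)) * A := by
    simp only [ι, Fintype.card_prod, Fintype.card_fin]
    have h1 : A + n * δ₀ ≤ 2 * A := by omega
    calc 2 * (T₀ * X * (E.d * E.d) * (A + n * δ₀)) ≤ 2 * (T₀ * X * (E.d * E.d) * (2 * A)) := by
          gcongr
      _ = 4 * (T₀ * X * E.d ^ 2) * A := by ring
      _ ≤ (D + 1) * (D + 1) * A := by
          apply Nat.mul_le_mul_right
          nlinarith [hcount]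
  obtain ⟨pp, hpp0, hppdeg, hppB, hppeq⟩ :=
    siegel_poly W (n * δ₀) A B hWδ hWB hB1 hι hAp hcard
  refine ⟨pp, hpp0, hppdeg, ?_, ?_⟩
  · intro l kk
    refine (hppB l kk).trans (le_of_eq ?_)
    simp only [Fintype.card_prod, Fintype.card_fin, hA, hB]
    push_cast
    ring
  · intro j hj m hm
    refine Matrix.ext fun i₁ i₂ => ?_
    have h := hppeq ((⟨j, hj⟩, ⟨m, hm⟩), (i₁, i₂))
    rw [homEval_Pmix, Matrix.sum_apply]
    simpa [W, Matrix.smul_apply] using h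

/-! ### Consequences for the auxiliary function -/

/-- The representing matrix of `∑_l C(pp_l)·(V j m l)` vanishing forces `F_p^{(j)}(s_m) = 0` for the
coefficient family `p_l = pp_l(θ)`. [cite: Chudnovsky1984, Ch. 7 §2 p. 307] -/
theorem iteratedDeriv_eq_zero {D n j m : ℕ} (pp : Fin (D + 1) × Fin (D + 1) → ℤ[X])
    (hn : D + D + j ≤ n) (h0 : homEval E.N E.b n (∑ l : Fin _ × Fin _, MvPolynomial.C (pp l) *
        MvPolynomial.map (Polynomial.C : ℤ →+* Polynomial ℤ) (V j m l.1 l.2)) = 0) :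
    iteratedDeriv j (F L D (fun l => Polynomial.aeval θ (pp l))) (s L m) = 0 := by
  rw [iteratedDeriv_F_s_eq_evC]
  exact E.evC_eq_zero_of_homEval_eq_zero
    (fun α hα => (degree_le_of_mem_support_Pmix pp j m hα).trans hn) h0

/-- A transcendental number is not a root of a nonzero integer polynomial. [folklore] -/
theorem aeval_ne_zero_of_transcendental (hθ : Transcendental ℚ θ) {q : ℤ[X]} (hq : q ≠ 0) :
    Polynomial.aeval θ q ≠ 0 := by
  intro h
  apply hθ
  refine ⟨q.map (algebraMap ℤ ℚ), ?_, ?_⟩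
  · exact (Polynomial.map_ne_zero_iff (algebraMap ℤ ℚ).injective_int).mpr hq
  · rwa [Polynomial.aeval_map_algebraMap]

/-- The coefficient family `p_l = pp_l(θ)` of a nonzero `pp` is nonzero (`θ` transcendental).
[folklore] -/
theorem coeffFamily_ne_zero (hθ : Transcendental ℚ θ) {D : ℕ}
    {pp : Fin (D + 1) × Fin (D + 1) → ℤ[X]} (hpp : pp ≠ 0) :
    (fun l => Polynomial.aeval θ (pp l)) ≠ 0 := by
  obtain ⟨l, hl⟩ := Function.ne_iff.mp hpp
  exact Function.ne_iff.mpr ⟨l, aeval_ne_zero_of_transcendental hθ hl⟩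

/-- The size of the coefficient family: `‖p‖ ≤ A · C_f · max(1,|θ|)^A` if `deg pp_l < A` and
`|coeff pp_l| ≤ C_f`. [folklore] -/
theorem norm_coeffFamily_le {D A : ℕ} {Cf : ℝ} (hCf : 0 ≤ Cf)
    {pp : Fin (D + 1) × Fin (D + 1) → ℤ[X]} (hdeg : ∀ l, (pp l).natDegree < A)
    (hcoeff : ∀ l kk, |((pp l).coeff kk : ℝ)| ≤ Cf) :
    ‖(fun l => Polynomial.aeval θ (pp l))‖ ≤ A * Cf * max 1 ‖θ‖ ^ A := by
  refine (pi_norm_le_iff_of_nonneg (by positivity)).mpr fun l => ?_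
  refine (norm_aeval_le_zl1 (pp l) θ).trans ?_
  have h1 : zl1 (pp l) ≤ ((pp l).natDegree + 1) * Cf := zl1_le_of_coeff_le _ (hcoeff l)
  have h2 : ((pp l).natDegree : ℝ) + 1 ≤ A := by exact_mod_cast hdeg l
  have h3 : max 1 ‖θ‖ ^ (pp l).natDegree ≤ max 1 ‖θ‖ ^ A :=
    pow_le_pow_right₀ (le_max_left _ _) (hdeg l).le
  calc zl1 (pp l) * max 1 ‖θ‖ ^ (pp l).natDegree ≤ ((pp l).natDegree + 1) * Cf * max 1 ‖θ‖ ^ A :=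
        mul_le_mul h1 h3 (by positivity) (by positivity)
    _ ≤ A * Cf * max 1 ‖θ‖ ^ A := by gcongr

/-- **The zero estimate applied**: if `T₁ X² > C_Z (D+1)(X+D)²` then some
`F_p^{(j₀)}(s_{m₀})`, `j₀ < T₁`, `m₀ < X`, is nonzero (`p ≠ 0`).
[cite: Chudnovsky1984, Ch. 7 Lemma 3.2 p. 310] -/
theorem exists_iteratedDeriv_ne_zero {C_Z : ℝ}
    (hZ : ∀ (D X T : ℕ), 1 ≤ X → ∀ p : Fin (D + 1) × Fin (D + 1) → ℂ, p ≠ 0 →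
      (∀ m < X, ∀ j < T, iteratedDeriv j (F L D p) (s L m) = 0) →
      (T : ℝ) * X ^ 2 ≤ C_Z * (D + 1) * ((X : ℝ) + D) ^ 2)
    {D X T₁ : ℕ} (hX : 1 ≤ X) {p : Fin (D + 1) × Fin (D + 1) → ℂ} (hp : p ≠ 0)
    (hT₁ : C_Z * (D + 1) * ((X : ℝ) + D) ^ 2 < (T₁ : ℝ) * X ^ 2) :
    ∃ j₀ < T₁, ∃ m₀ < X, iteratedDeriv j₀ (F L D p) (s L m₀) ≠ 0 := by
  by_contra hcon
  push Not at hcon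
  have := hZ D X T₁ hX p hp fun m hm j hj => hcon j hj m hm
  linarith

/-! ### The norm polynomial `Q = det (homEval N b n₁ (∑ l : Fin _ × Fin _, MvPolynomial.C (pp l) *
        MvPolynomial.map (Polynomial.C : ℤ →+* Polynomial ℤ) (V j₀ m₀ l.1 l.2)))` -/

section Norm

variable {D : ℕ} (pp : Fin (D + 1) × Fin (D + 1) → ℤ[X]) (j₀ m₀ n₁ : ℕ)

/-- `Q(θ) ≠ 0` as soon as `ξ = F_p^{(j₀)}(s_{m₀}) ≠ 0` (the norm of a nonzero element).
[cite: Chudnovsky1984, Ch. 7 §2 p. 307] -/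
theorem aeval_det_ne_zero (hn : D + D + j₀ ≤ n₁)
    (hξ : iteratedDeriv j₀ (F L D (fun l => Polynomial.aeval θ (pp l))) (s L m₀) ≠ 0) :
    Polynomial.aeval θ (homEval E.N E.b n₁ (∑ l : Fin _ × Fin _, MvPolynomial.C (pp l) *
        MvPolynomial.map (Polynomial.C : ℤ →+* Polynomial ℤ) (V j₀ m₀ l.1 l.2))).det ≠ 0 := by
  refine E.det_ne n₁ _ (fun α hα => (degree_le_of_mem_support_Pmix pp j₀ m₀ hα).trans hn) ?_
  rwa [← iteratedDeriv_F_s_eq_evC]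

/-- Degrees of the coefficients of `∑_l C(pp_l)·(V j m l)`: `≤ max deg pp_l`. [folklore] -/
theorem natDegree_coeff_Pmix_le {A : ℕ} (hdeg : ∀ l, (pp l).natDegree < A) (j m : ℕ)
    (α : Fin 4 →₀ ℕ) : ((∑ l : Fin _ × Fin _, MvPolynomial.C (pp l) *
        MvPolynomial.map (Polynomial.C : ℤ →+* Polynomial ℤ) (V j m l.1 l.2)).coeff α).natDegree ≤ A := by
  rw [coeff_Pmix]
  refine Polynomial.natDegree_sum_le_of_forall_le _ _ fun l _ => ?_
  refine Polynomial.natDegree_mul_le.trans ?_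
  rw [Polynomial.natDegree_C, add_zero]
  exact (hdeg l).le

/-- Height of `∑_l C(pp_l)·(V j m l)`: `wnorm ≤ ∑_l zl1(pp_l) · l1(V j m l)`. [folklore] -/
theorem wnorm_Pmix_le (j m : ℕ) :
    wnorm zl1 (∑ l : Fin _ × Fin _, MvPolynomial.C (pp l) *
        MvPolynomial.map (Polynomial.C : ℤ →+* Polynomial ℤ) (V j m l.1 l.2)) ≤ ∑ l : Fin (D + 1) × Fin (D + 1), zl1 (pp l) * l1 (V j m l.1 l.2) := by
  refine (wnorm_sum_le _ _ _).trans (Finset.sum_le_sum fun l _ => ?_)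
  refine (wnorm_mul_le _ _ _).trans ?_
  rw [wnorm_C]
  refine mul_le_mul_of_nonneg_left ?_ (apply_nonneg _ _)
  exact wnorm_map_le _ _ _ (fun a => by rw [zl1_C, normRingSeminorm_int_apply]) _

/-- **Degree of `Q`**: `≤ d (A + n₁ δ₀)`. [cite: Chudnovsky1984, Ch. 7 §2 p. 307] -/
theorem natDegree_det_le {δ₀ A : ℕ} (hNδ : ∀ l i j, (E.N l i j).natDegree ≤ δ₀)
    (hbδ : E.b.natDegree ≤ δ₀) (hdeg : ∀ l, (pp l).natDegree < A) (hn : D + D + j₀ ≤ n₁) :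
    (homEval E.N E.b n₁ (∑ l : Fin _ × Fin _, MvPolynomial.C (pp l) *
        MvPolynomial.map (Polynomial.C : ℤ →+* Polynomial ℤ) (V j₀ m₀ l.1 l.2))).det.natDegree ≤ E.d * (A + n₁ * δ₀) :=
  natDegree_det_le_of_entry fun i j => natDegree_homEval_entry_le hNδ hbδ
    (fun _ hα => (degree_le_of_mem_support_Pmix pp j₀ m₀ hα).trans hn)
    (natDegree_coeff_Pmix_le pp hdeg j₀ m₀) i j

/-- **Entries of `Y = homEval N b n₁ ∑_l C(pp_l)·(V j₀ m₀ l)`**: `zl1 ≤ H_Y` with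
`H_Y = (D+1)² A C_f (7n₁)^{n₁} X^{n₁} · d³ (dH₀)^{n₁}` (`deg pp_l < A`, `|coeff pp_l| ≤ C_f`,
`j₀ ≤ n₁ - 2D`, `m₀ < X`). [folklore] -/
theorem zl1_entry_le {H₀ Cf : ℝ} (hH₀ : 1 ≤ H₀) (hCf : 0 ≤ Cf)
    (hNH : ∀ l i j, zl1 (E.N l i j) ≤ H₀) (hbH : zl1 E.b ≤ H₀) {A X : ℕ}
    (hdeg : ∀ l, (pp l).natDegree < A) (hcoeff : ∀ l kk, |((pp l).coeff kk : ℝ)| ≤ Cf)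
    (hn : D + D + j₀ ≤ n₁) (hn1 : 1 ≤ n₁) (hm₀ : m₀ < X) (i j : Fin E.d) :
    zl1 (homEval E.N E.b n₁ (∑ l : Fin _ × Fin _, MvPolynomial.C (pp l) *
        MvPolynomial.map (Polynomial.C : ℤ →+* Polynomial ℤ) (V j₀ m₀ l.1 l.2)) i j) ≤
      ((D : ℝ) + 1) ^ 2 * (A * Cf) * ((7 * (n₁ : ℝ)) ^ n₁ * (X : ℝ) ^ n₁) *
        ((E.d : ℝ) ^ 3 * (E.d * H₀) ^ n₁) := by
  have hsupp : ∀ α ∈ (∑ l : Fin _ × Fin _, MvPolynomial.C (pp l) *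
        MvPolynomial.map (Polynomial.C : ℤ →+* Polynomial ℤ) (V j₀ m₀ l.1 l.2)).support, α.degree ≤ n₁ := fun α hα =>
    (degree_le_of_mem_support_Pmix pp j₀ m₀ hα).trans hn
  refine (seminorm_homEval_entry_le zl1 zl1_one.le hH₀ hNH hbH hsupp i j).trans ?_
  refine mul_le_mul_of_nonneg_right ?_ (by positivity)
  refine (wnorm_Pmix_le pp j₀ m₀).trans ?_
  have h7 : (1 : ℝ) ≤ 7 * (n₁ : ℝ) := by
    have : (1 : ℝ) ≤ n₁ := by exact_mod_cast hn1
    linarith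
  have hX1 : (1 : ℝ) ≤ X := by
    have : 1 ≤ X := by omega
    exact_mod_cast this
  have hterm : ∀ l : Fin (D + 1) × Fin (D + 1),
      zl1 (pp l) * l1 (V j₀ m₀ l.1 l.2) ≤ (A * Cf) * ((7 * (n₁ : ℝ)) ^ n₁ * (X : ℝ) ^ n₁) := by
    intro l
    have h1 : zl1 (pp l) ≤ A * Cf := by
      refine (zl1_le_of_coeff_le _ (hcoeff l)).trans ?_
      gcongr
      exact_mod_cast hdeg l
    have hl1 : (l.1 : ℕ) ≤ D := Nat.lt_succ_iff.mp l.1.2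
    have hl2 : (l.2 : ℕ) ≤ D := Nat.lt_succ_iff.mp l.2.2
    have hikj : (l.1 : ℕ) + l.2 + j₀ ≤ n₁ := by omega
    have h2 : l1 (V j₀ m₀ l.1 l.2) ≤ (7 * (n₁ : ℝ)) ^ n₁ * (X : ℝ) ^ n₁ := by
      refine (l1_V_le j₀ m₀ l.1 l.2).trans ?_
      have hm : (m₀ : ℝ) + 1 ≤ X := by exact_mod_cast hm₀
      have hikj' : 7 * (((l.1 : ℕ) : ℝ) + (l.2 : ℕ) + j₀) ≤ 7 * (n₁ : ℝ) := by
        gcongr; exact_mod_cast hikj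
      refine mul_le_mul ?_ ?_ (by positivity) (by positivity)
      · exact (pow_le_pow_left₀ (by positivity) hikj' _).trans (pow_le_pow_right₀ h7 (by omega))
      · exact (pow_le_pow_left₀ (by positivity) hm _).trans (pow_le_pow_right₀ hX1 hikj)
    exact mul_le_mul h1 h2 (wnorm_nonneg _ _) (by positivity)
  calc ∑ l : Fin (D + 1) × Fin (D + 1), zl1 (pp l) * l1 (V j₀ m₀ l.1 l.2)
      ≤ ∑ _l : Fin (D + 1) × Fin (D + 1), (A * Cf) * ((7 * (n₁ : ℝ)) ^ n₁ * (X : ℝ) ^ n₁) :=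
        Finset.sum_le_sum fun l _ => hterm l
    _ = ((D : ℝ) + 1) ^ 2 * (A * Cf) * ((7 * (n₁ : ℝ)) ^ n₁ * (X : ℝ) ^ n₁) := by
        rw [Finset.sum_const, Finset.card_univ, Fintype.card_prod, Fintype.card_fin, nsmul_eq_mul]
        push_cast; ring

/-- **The lower-bound side**: `|Q(θ)| ≤ |b(θ)|^{n₁} |ξ| · d (1 + d R)^d`, where `R` bounds the
entries `|Y(θ)_{ij}| ≤ zl1(Y_{ij}) max(1,|θ|)^{deg Y_{ij}}` (cofactor bound with the eigenvector
`β`). [cite: Chudnovsky1984, Ch. 7 §2 p. 307] -/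
theorem norm_aeval_det_le {HY : ℝ} {δY : ℕ} (hHY : 0 ≤ HY)
    (hY : ∀ i j, zl1 (homEval E.N E.b n₁ (∑ l : Fin _ × Fin _, MvPolynomial.C (pp l) *
        MvPolynomial.map (Polynomial.C : ℤ →+* Polynomial ℤ) (V j₀ m₀ l.1 l.2)) i j) ≤ HY)
    (hYδ : ∀ i j, (homEval E.N E.b n₁ (∑ l : Fin _ × Fin _, MvPolynomial.C (pp l) *
        MvPolynomial.map (Polynomial.C : ℤ →+* Polynomial ℤ) (V j₀ m₀ l.1 l.2)) i j).natDegree ≤ δY)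
    (hn : D + D + j₀ ≤ n₁) :
    ‖Polynomial.aeval θ (homEval E.N E.b n₁ (∑ l : Fin _ × Fin _, MvPolynomial.C (pp l) *
        MvPolynomial.map (Polynomial.C : ℤ →+* Polynomial ℤ) (V j₀ m₀ l.1 l.2))).det‖ ≤
      ‖Polynomial.aeval θ E.b ^ n₁ *
          iteratedDeriv j₀ (F L D (fun l => Polynomial.aeval θ (pp l))) (s L m₀)‖ *
        (E.d * (1 + E.d * (HY * max 1 ‖θ‖ ^ δY)) ^ E.d) := by
  set Y := homEval E.N E.b n₁ (∑ l : Fin _ × Fin _, MvPolynomial.C (pp l) *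
        MvPolynomial.map (Polynomial.C : ℤ →+* Polynomial ℤ) (V j₀ m₀ l.1 l.2)) with hYdef
  have hsupp : ∀ α ∈ (∑ l : Fin _ × Fin _, MvPolynomial.C (pp l) *
        MvPolynomial.map (Polynomial.C : ℤ →+* Polynomial ℤ) (V j₀ m₀ l.1 l.2)).support, α.degree ≤ n₁ := fun α hα =>
    (degree_le_of_mem_support_Pmix pp j₀ m₀ hα).trans hn
  have heig := E.vecMul_homEval hsupp
  rw [← iteratedDeriv_F_s_eq_evC] at heig
  have hmap : Polynomial.aeval θ Y.det =
      (Y.map (Polynomial.aeval θ : ℤ[X] →ₐ[ℤ] ℂ)).det := by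
    rw [show (Polynomial.aeval θ : ℤ[X] →ₐ[ℤ] ℂ) Y.det =
      (Polynomial.aeval θ : ℤ[X] →ₐ[ℤ] ℂ).toRingHom Y.det from rfl, RingHom.map_det]
    rfl
  rw [hmap]
  refine norm_det_le_of_vecMul _ E.β_ne heig fun i j => ?_
  rw [Matrix.map_apply]
  refine (norm_aeval_le_zl1 (Y i j) θ).trans ?_
  exact mul_le_mul (hY i j) (pow_le_pow_right₀ (le_max_left _ _) (hYδ i j))
    (by positivity) hHY

end Norm

end Literature.NumberTheory.Transcendental.Chudnovsky

end
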